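import Literature.Analysis.FunctionSpaces.MorreyInequality
import Mathlib.Analysis.Calculus.FDeriv.Measurable
import HarnessLib

/-!
# Morrey's inequality on convex open sets for maps `C¹` on the set

Topic `Literature/Analysis/FunctionSpaces`. Proved results (no named facts): the `C¹` half of
Morrey's imbedding `W^{1,p}(Ω) ⊂ C^{0,1-n/p}(Ω̄)`, `p > n`, on a **convex** open set `Ω`
(R. A. Adams, *Sobolev Spaces* (1975), Lemma 5.17: `W^{m,p}(Ω) → C^{0,λ}(Ω̄)` for `Ω` with the
strong local Lipschitz property and `mp > n ≥ (m-1)p`, whose proof for `m = 1` runs on a cube /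
parallelepiped and only uses that it is convex: (28) `|u(x) - u(y)| ≤ …` by integration along
segments inside the convex cell and Hölder's inequality; L. C. Evans, *PDE*, 2nd ed. (2010),
§5.6.2, Theorem 4, Steps 1–3, and Remark after Theorem 5: "a variant of the proof above" gives
the estimate on balls `B(x, r)`), for maps `h : E → F` that are `C¹` on `Ω` only, with the `L^p`
norm of `Dh` taken over `Ω`:

* `enorm_sub_le_lintegral_fderiv_segment_of_convex` — integration along a segment of `Ω`;
* `lintegral_enorm_sub_le_of_convex` — the **mean-oscillation estimate**
  `∫_W ‖h z - h x‖ dμ ≤ K r μ(B_r)^{1-1/p} ‖Dh‖_{L^p(Ω)}` for measurable `W ⊆ Ω ∩ B(x, r)`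
  (Adams, proof of Lemma 5.17, the chain ending in (29); Evans, Theorem 4, Step 1);
* `mul_enorm_sub_le_of_convex` — the **two-point estimate**
  `μ(W) ‖h x - h y‖ ≤ 2 K r μ(B_r)^{1-1/p} ‖Dh‖_{L^p(Ω)}` for `W ⊆ Ω ∩ B(x, r) ∩ B(y, r)`
  (Evans, Step 3), and `mul_enorm_le_of_convex`, the **one-point estimate**
  `μ(W) ‖h x‖ ≤ ∫_W ‖h‖ + K r μ(B_r)^{1-1/p} ‖Dh‖_{L^p(Ω)}` (Evans, Step 2);
* `morrey_holder_of_convex`, `morrey_sup_of_convex` — the **Hölder and sup estimates** on a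
  bounded convex open set containing a ball `B(c₀, R₀)` and contained in `B(c₀, D)`:
  `‖h x - h y‖ ≤ C ‖Dh‖_{L^p(Ω)} ‖x - y‖^{1-n/p}` and `‖h x‖ ≤ C (‖h‖_{L^p(Ω)} + ‖Dh‖_{L^p(Ω)})`
  for `x, y ∈ Ω`, `C` depending only on `E, μ, p, R₀, D` (the witness sets `W` being the balls
  `B(m + s(c₀ - m), s R₀) ⊆ Ω ∩ B(m, s D')` supplied by convexity — the uniform cone property of
  a convex body, Adams ¶4.3–¶4.7).

The whole-space versions (`Ω = E`, `W` a ball) are `MorreyInequality`'s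
`lintegral_ball_enorm_sub_center_le`, `morrey_holder`, `morrey_sup`, whose proofs are followed
line by line: `h(z) - h(x) = ∫₀¹ Dh(x + t(z-x))(z-x) dt` inside `Ω` (convexity), integrate over
`z ∈ W`, substitute `w = x + t(z-x)` (Jacobian `t⁻ⁿ`, `Measure.map_addHaar_smul`), which maps `W`
into `Ω ∩ B(x, tr)` (convexity again), Hölder there against `‖Dh‖_{L^p(Ω)}`, and
`∫₀¹ t^{-n/p} dt < ∞`. Measurability of `Dh` off `Ω` is irrelevant but available
(`measurable_fderiv`). Consumed by the Sobolev imbedding on the period cell of the cylinder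
(`FluidPDE`).

## Mathlib / tree search

Mathlib (this pin) has no Morrey inequality (`lean search 'Morrey'`); the tree has the
whole-space `C¹` versions (`MorreyInequality`, `SobolevImbeddingSup`) and the qualitative
`W^{1,p}` embedding `morrey_embedding_holds` on the whole space only.

## References

* R. A. Adams, *Sobolev Spaces*, Academic Press (1975), Lemma 5.17 and (28)–(29), ¶4.3–¶4.7.
* L. C. Evans, *Partial Differential Equations*, 2nd ed., AMS GSM 19 (2010), §5.6.2,
  Theorems 4–5 and the Remark following Theorem 5.
-/

noncomputable section

open MeasureTheory Metric Set Filter Topology Module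
open scoped ENNReal NNReal ContDiff

namespace Literature.Analysis.FunctionSpaces

variable {E : Type*} [NormedAddCommGroup E] [NormedSpace ℝ E]
variable {F : Type*} [NormedAddCommGroup F] [NormedSpace ℝ F]

/-! ### Integration along a segment of a convex open set -/

/-- Integration along the segment `[x, z] ⊆ Ω`, difference form, for a map `C¹` on the convex
open set `Ω`: `‖h z - h x‖ ≤ ∫₀¹ ‖Dh(x + t(z - x))‖ ‖z - x‖ dt` (in `ℝ≥0∞`). [folklore] -/
theorem enorm_sub_le_lintegral_fderiv_segment_of_convex [CompleteSpace F] {Ω : Set E}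
    (hΩo : IsOpen Ω) (hΩc : Convex ℝ Ω) {h : E → F} (hh : ContDiffOn ℝ 1 h Ω) {x z : E}
    (hx : x ∈ Ω) (hz : z ∈ Ω) :
    ‖h z - h x‖ₑ ≤ ∫⁻ t in Ioc (0 : ℝ) 1, ‖fderiv ℝ h (x + t • (z - x))‖ₑ * ‖z - x‖ₑ := by
  -- the segment lies in `Ω`
  have hseg : ∀ t ∈ Icc (0 : ℝ) 1, x + t • (z - x) ∈ Ω := fun t ht =>
    hΩc.add_smul_sub_mem hx hz ht
  have hpath : Continuous fun t : ℝ => x + t • (z - x) :=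
    continuous_const.add (continuous_id.smul continuous_const)
  have hDcont : ContinuousOn (fderiv ℝ h) Ω := hh.continuousOn_fderiv_of_isOpen hΩo le_rfl
  -- derivative of `t ↦ h (x + t • (z - x))` on `[0, 1]`
  have hderiv : ∀ t ∈ uIcc (0 : ℝ) 1, HasDerivAt (fun s : ℝ => h (x + s • (z - x)))
      (fderiv ℝ h (x + t • (z - x)) (z - x)) t := by
    rw [uIcc_of_le zero_le_one]
    intro t ht
    have h1 : HasDerivAt (fun s : ℝ => x + s • (z - x)) (z - x) t := by
      simpa using ((hasDerivAt_id t).smul_const (z - x)).const_add x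
    have hd : DifferentiableAt ℝ h (x + t • (z - x)) :=
      ((hh.differentiableOn one_ne_zero) _ (hseg t ht)).differentiableAt
        (hΩo.mem_nhds (hseg t ht))
    exact hd.hasFDerivAt.comp_hasDerivAt t h1
  have hcontOn : ContinuousOn (fun t : ℝ => fderiv ℝ h (x + t • (z - x))) (Icc 0 1) :=
    hDcont.comp hpath.continuousOn fun t ht => hseg t ht
  have hcont : ContinuousOn (fun t : ℝ => fderiv ℝ h (x + t • (z - x)) (z - x)) (Icc 0 1) :=
    hcontOn.clm_apply continuousOn_const
  have hcont' : ContinuousOn (fun t : ℝ => ‖fderiv ℝ h (x + t • (z - x))‖ * ‖z - x‖) (Icc 0 1) :=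
    hcontOn.norm.mul continuousOn_const
  have hFTC : ∫ t in (0 : ℝ)..1, fderiv ℝ h (x + t • (z - x)) (z - x) =
      h (x + (1 : ℝ) • (z - x)) - h (x + (0 : ℝ) • (z - x)) :=
    intervalIntegral.integral_eq_sub_of_hasDerivAt hderiv
      (hcont.intervalIntegrable_of_Icc zero_le_one)
  rw [one_smul, zero_smul, add_zero, add_sub_cancel] at hFTC
  -- real inequality
  have hreal : ‖h z - h x‖ ≤ ∫ t in (0 : ℝ)..1, ‖fderiv ℝ h (x + t • (z - x))‖ * ‖z - x‖ := by
    calc ‖h z - h x‖ = ‖∫ t in (0 : ℝ)..1, fderiv ℝ h (x + t • (z - x)) (z - x)‖ := by rw [hFTC]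
      _ ≤ ∫ t in (0 : ℝ)..1, ‖fderiv ℝ h (x + t • (z - x)) (z - x)‖ :=
          intervalIntegral.norm_integral_le_integral_norm zero_le_one
      _ ≤ ∫ t in (0 : ℝ)..1, ‖fderiv ℝ h (x + t • (z - x))‖ * ‖z - x‖ := by
          refine intervalIntegral.integral_mono_on zero_le_one
            ((hcont.intervalIntegrable_of_Icc zero_le_one).norm)
            (hcont'.intervalIntegrable_of_Icc zero_le_one) fun t _ => ?_
          exact ContinuousLinearMap.le_opNorm _ _
  -- pass to `ℝ≥0∞`
  have hI : ENNReal.ofReal (∫ t in (0 : ℝ)..1, ‖fderiv ℝ h (x + t • (z - x))‖ * ‖z - x‖) =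
      ∫⁻ t in Ioc (0 : ℝ) 1, ‖fderiv ℝ h (x + t • (z - x))‖ₑ * ‖z - x‖ₑ := by
    rw [intervalIntegral.integral_of_le zero_le_one,
      ofReal_integral_eq_lintegral_ofReal
        ((hcont'.integrableOn_Icc).mono_set Ioc_subset_Icc_self)
        (Eventually.of_forall fun t => by positivity)]
    refine lintegral_congr fun t => ?_
    rw [ENNReal.ofReal_mul (norm_nonneg _), ofReal_norm, ofReal_norm]
  calc ‖h z - h x‖ₑ = ENNReal.ofReal ‖h z - h x‖ := (ofReal_norm _).symm
    _ ≤ ENNReal.ofReal (∫ t in (0 : ℝ)..1, ‖fderiv ℝ h (x + t • (z - x))‖ * ‖z - x‖) :=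
        ENNReal.ofReal_le_ofReal hreal
    _ = _ := hI

/-! ### The mean-oscillation estimate on a convex open set -/

section Morrey

variable [MeasurableSpace E] [BorelSpace E] [FiniteDimensional ℝ E] (μ : Measure E)
  [μ.IsAddHaarMeasure]

omit [NormedSpace ℝ E] [FiniteDimensional ℝ E] in
/-- Change of variables `w = x + t • (z - x)` in a lower integral against Haar measure:
`∫ G (x + t • (z - x)) dμ(z) = |t ^ n|⁻¹ ∫ G dμ` for `t ≠ 0`, `n = dim E`. [folklore] -/
theorem lintegral_comp_add_smul_sub [NormedSpace ℝ E] [FiniteDimensional ℝ E] (G : E → ℝ≥0∞)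
    (hG : Measurable G) (x : E) {t : ℝ} (ht : t ≠ 0) :
    ∫⁻ z, G (x + t • (z - x)) ∂μ = ENNReal.ofReal (|(t ^ finrank ℝ E)⁻¹|) * ∫⁻ w, G w ∂μ := by
  have h1 : ∫⁻ z, G (x + t • (z - x)) ∂μ = ∫⁻ z, G (x + t • z) ∂μ :=
    lintegral_sub_right_eq_self (μ := μ) (fun z => G (x + t • z)) x
  have hGx : Measurable fun u => G (x + u) := hG.comp (measurable_const_add x)
  have h2 : ∫⁻ z, G (x + t • z) ∂μ = ∫⁻ u, G (x + u) ∂(Measure.map (fun z : E => t • z) μ) :=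
    (lintegral_map hGx (measurable_const_smul t)).symm
  rw [h1, h2, Measure.map_addHaar_smul μ ht, lintegral_smul_measure, smul_eq_mul,
    lintegral_add_left_eq_self]

/-- **Mean-oscillation estimate on a convex open set** (Adams, *Sobolev Spaces* (1975), proof
of Lemma 5.17, the chain of inequalities ending in (29), run inside a convex cell; Evans, *PDE*,
§5.6.2, Theorem 4, Step 1): for `1 ≤ p`, `n = dim E < p` there is a finite `K` (namely
`∫₀¹ t^{-n/p} dt`) such that for every convex open `Ω`, every map `h` of class `C¹` on `Ω`,
every `x ∈ Ω`, `r > 0` and measurable `W ⊆ Ω ∩ B(x, r)`,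
`∫_W ‖h z - h x‖ dμ ≤ K r μ(B(0,r))^{1-1/p} ‖Dh‖_{L^p(Ω)}`. [cite: Adams1975, Lemma 5.17 (proof, (28)–(29))] -/
theorem lintegral_enorm_sub_le_of_convex [CompleteSpace F] {p : ℝ≥0} (hp1 : 1 ≤ p)
    (hp : (finrank ℝ E : ℝ) < p) :
    ∃ K : ℝ≥0∞, K < ⊤ ∧ ∀ ⦃Ω : Set E⦄, IsOpen Ω → Convex ℝ Ω → ∀ ⦃h : E → F⦄,
      ContDiffOn ℝ 1 h Ω → ∀ ⦃x : E⦄, x ∈ Ω → ∀ ⦃r : ℝ⦄, 0 < r → ∀ ⦃W : Set E⦄,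
      MeasurableSet W → W ⊆ Ω ∩ ball x r →
      ∫⁻ z in W, ‖h z - h x‖ₑ ∂μ ≤
        K * ENNReal.ofReal r * μ (ball (0 : E) r) ^ (1 - (p : ℝ)⁻¹) *
          eLpNorm (fderiv ℝ h) p (μ.restrict Ω) := by
  refine ⟨∫⁻ t in Ioc (0 : ℝ) 1, ENNReal.ofReal ((t ^ finrank ℝ E)⁻¹ *
      (t ^ finrank ℝ E) ^ (1 - (p : ℝ)⁻¹)), lintegral_morrey_weight_lt_top hp1 hp,
    fun Ω hΩo hΩc h hh x hx r hr W hWm hW => ?_⟩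
  set n := finrank ℝ E
  set a : ℝ := 1 - (p : ℝ)⁻¹ with ha
  have ha0 : 0 ≤ a := by
    rw [ha, sub_nonneg]; exact inv_le_one_of_one_le₀ (by exact_mod_cast hp1)
  set N := eLpNorm (fderiv ℝ h) p (μ.restrict Ω)
  set Kw := ∫⁻ t in Ioc (0 : ℝ) 1, ENNReal.ofReal ((t ^ n)⁻¹ * (t ^ n) ^ a)
  have hDmeas : Measurable (fderiv ℝ h) := measurable_fderiv ℝ h
  have hDcont : ContinuousOn (fderiv ℝ h) Ω := hh.continuousOn_fderiv_of_isOpen hΩo le_rfl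
  have hWΩ : W ⊆ Ω := fun z hz => (hW hz).1
  have hWB : W ⊆ ball x r := fun z hz => (hW hz).2
  have hpathm : Measurable fun q : E × ℝ => x + q.2 • (q.1 - x) :=
    (continuous_const.add (continuous_snd.smul (continuous_fst.sub continuous_const))).measurable
  have hmeas2 : Measurable fun q : E × ℝ => ‖fderiv ℝ h (x + q.2 • (q.1 - x))‖ₑ :=
    (hDmeas.comp hpathm).enorm
  -- Step 1: integrate the segment inequality over `W`
  have h1 : ∫⁻ z in W, ‖h z - h x‖ₑ ∂μ ≤ ENNReal.ofReal r *
      ∫⁻ z in W, ∫⁻ t in Ioc (0 : ℝ) 1, ‖fderiv ℝ h (x + t • (z - x))‖ₑ ∂volume ∂μ := by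
    calc ∫⁻ z in W, ‖h z - h x‖ₑ ∂μ
        ≤ ∫⁻ z in W, (∫⁻ t in Ioc (0 : ℝ) 1, ‖fderiv ℝ h (x + t • (z - x))‖ₑ ∂volume) *
            ENNReal.ofReal r ∂μ := by
          refine setLIntegral_mono' hWm fun z hz => ?_
          refine (enorm_sub_le_lintegral_fderiv_segment_of_convex hΩo hΩc hh hx (hWΩ hz)).trans ?_
          have hz1 : ‖z - x‖ₑ ≤ ENNReal.ofReal r := by
            rw [← ofReal_norm]
            exact ENNReal.ofReal_le_ofReal (mem_ball_iff_norm.1 (hWB hz)).le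
          have hmz : Measurable fun t : ℝ => ‖fderiv ℝ h (x + t • (z - x))‖ₑ :=
            (hDmeas.comp (continuous_const.add (continuous_id.smul continuous_const)).measurable).enorm
          calc ∫⁻ t in Ioc (0 : ℝ) 1, ‖fderiv ℝ h (x + t • (z - x))‖ₑ * ‖z - x‖ₑ
              ≤ ∫⁻ t in Ioc (0 : ℝ) 1, ‖fderiv ℝ h (x + t • (z - x))‖ₑ * ENNReal.ofReal r :=
                lintegral_mono fun t => by gcongr
            _ = (∫⁻ t in Ioc (0 : ℝ) 1, ‖fderiv ℝ h (x + t • (z - x))‖ₑ) * ENNReal.ofReal r :=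
                lintegral_mul_const _ hmz
      _ = ENNReal.ofReal r * ∫⁻ z in W, ∫⁻ t in Ioc (0 : ℝ) 1,
            ‖fderiv ℝ h (x + t • (z - x))‖ₑ ∂volume ∂μ := by
          have hm : Measurable fun z : E => ∫⁻ t in Ioc (0 : ℝ) 1,
              ‖fderiv ℝ h (x + t • (z - x))‖ₑ := hmeas2.lintegral_prod_right'
          rw [lintegral_mul_const _ hm, mul_comm]
  -- Step 2: Tonelli
  have h2 : ∫⁻ z in W, ∫⁻ t in Ioc (0 : ℝ) 1, ‖fderiv ℝ h (x + t • (z - x))‖ₑ ∂volume ∂μ =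
      ∫⁻ t in Ioc (0 : ℝ) 1, ∫⁻ z in W, ‖fderiv ℝ h (x + t • (z - x))‖ₑ ∂μ ∂volume :=
    lintegral_lintegral_swap hmeas2.aemeasurable
  -- Step 3: change of variables + Hölder for fixed `t ∈ (0, 1]`
  have h3 : ∀ t ∈ Ioc (0 : ℝ) 1, ∫⁻ z in W, ‖fderiv ℝ h (x + t • (z - x))‖ₑ ∂μ ≤
      N * μ (ball (0 : E) r) ^ a * ENNReal.ofReal ((t ^ n)⁻¹ * (t ^ n) ^ a) := by
    intro t ht
    have ht0 : 0 < t := ht.1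
    set S : Set E := Ω ∩ ball x (t * r) with hS
    have hSm : MeasurableSet S := hΩo.measurableSet.inter measurableSet_ball
    set G : E → ℝ≥0∞ := S.indicator fun w => ‖fderiv ℝ h w‖ₑ with hG
    have hGm : Measurable G := hDmeas.enorm.indicator hSm
    -- `z ∈ W ⇒ x + t • (z - x) ∈ S`
    have hmem : ∀ z ∈ W, x + t • (z - x) ∈ S := by
      intro z hz
      refine ⟨hΩc.add_smul_sub_mem hx (hWΩ hz) ⟨ht0.le, ht.2⟩, ?_⟩
      rw [mem_ball_iff_norm, add_sub_cancel_left, norm_smul, Real.norm_of_nonneg ht0.le]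
      exact mul_lt_mul_of_pos_left (mem_ball_iff_norm.1 (hWB hz)) ht0
    have hHolder : ∫⁻ w in S, ‖fderiv ℝ h w‖ₑ ∂μ ≤ N * μ (ball (0 : E) (t * r)) ^ a := by
      calc ∫⁻ w in S, ‖fderiv ℝ h w‖ₑ ∂μ
          = eLpNorm (fderiv ℝ h) 1 (μ.restrict S) := eLpNorm_one_eq_lintegral_enorm.symm
        _ ≤ eLpNorm (fderiv ℝ h) p (μ.restrict S) *
              (μ.restrict S) univ ^ (1 / (1 : ℝ≥0∞).toReal - 1 / ((p : ℝ≥0∞)).toReal) :=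
            eLpNorm_le_eLpNorm_mul_rpow_measure_univ (by exact_mod_cast hp1)
              ((hDcont.mono inter_subset_left).aestronglyMeasurable hSm)
        _ ≤ N * μ (ball (0 : E) (t * r)) ^ a := by
            rw [Measure.restrict_apply_univ]
            have hexp : 1 / (1 : ℝ≥0∞).toReal - 1 / ((p : ℝ≥0∞)).toReal = a := by
              simp [ha]
            rw [hexp]
            have hμS : μ S ≤ μ (ball (0 : E) (t * r)) :=
              (measure_mono inter_subset_right).trans_eq (Measure.addHaar_ball_center μ x (t * r))
            exact mul_le_mul' (eLpNorm_mono_measure _ (Measure.restrict_mono inter_subset_left le_rfl))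
              (ENNReal.rpow_le_rpow hμS ha0)
    calc ∫⁻ z in W, ‖fderiv ℝ h (x + t • (z - x))‖ₑ ∂μ
        = ∫⁻ z, W.indicator (fun z => ‖fderiv ℝ h (x + t • (z - x))‖ₑ) z ∂μ :=
          (lintegral_indicator hWm _).symm
      _ ≤ ∫⁻ z, G (x + t • (z - x)) ∂μ := by
          refine lintegral_mono fun z => ?_
          by_cases hz : z ∈ W
          · rw [indicator_of_mem hz, hG, indicator_of_mem (hmem z hz)]
          · rw [indicator_of_notMem hz]
            exact zero_le
      _ = ENNReal.ofReal (|(t ^ n)⁻¹|) * ∫⁻ w, G w ∂μ :=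
          lintegral_comp_add_smul_sub μ G hGm x ht0.ne'
      _ = ENNReal.ofReal (|(t ^ n)⁻¹|) * ∫⁻ w in S, ‖fderiv ℝ h w‖ₑ ∂μ := by
          rw [hG, lintegral_indicator hSm]
      _ ≤ ENNReal.ofReal ((t ^ n)⁻¹) * (N * μ (ball (0 : E) (t * r)) ^ a) := by
          rw [abs_of_nonneg (by positivity)]
          gcongr
      _ = N * μ (ball (0 : E) r) ^ a * ENNReal.ofReal ((t ^ n)⁻¹ * (t ^ n) ^ a) := by
          rw [Measure.addHaar_ball_mul_of_pos μ (0 : E) ht0 r,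
            ENNReal.mul_rpow_of_nonneg _ _ ha0, ENNReal.ofReal_rpow_of_pos (pow_pos ht0 n),
            ENNReal.ofReal_mul (inv_nonneg.2 (pow_nonneg ht0.le n))]
          ring
  -- Step 4: integrate in `t`
  have h4 : ∫⁻ t in Ioc (0 : ℝ) 1, ∫⁻ z in W, ‖fderiv ℝ h (x + t • (z - x))‖ₑ ∂μ ∂volume ≤
      μ (ball (0 : E) r) ^ a * Kw * N := by
    calc ∫⁻ t in Ioc (0 : ℝ) 1, ∫⁻ z in W, ‖fderiv ℝ h (x + t • (z - x))‖ₑ ∂μ ∂volume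
        ≤ ∫⁻ t in Ioc (0 : ℝ) 1, N * μ (ball (0 : E) r) ^ a *
            ENNReal.ofReal ((t ^ n)⁻¹ * (t ^ n) ^ a) ∂volume := setLIntegral_mono' measurableSet_Ioc h3
      _ = N * μ (ball (0 : E) r) ^ a * Kw := by
          refine lintegral_const_mul _ ?_
          refine Measurable.ennreal_ofReal ?_
          exact ((measurable_id.pow_const n).inv).mul ((measurable_id.pow_const n).pow_const a)
      _ = _ := by ring
  calc ∫⁻ z in W, ‖h z - h x‖ₑ ∂μ
      ≤ ENNReal.ofReal r * ∫⁻ z in W, ∫⁻ t in Ioc (0 : ℝ) 1,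
          ‖fderiv ℝ h (x + t • (z - x))‖ₑ ∂volume ∂μ := h1
    _ ≤ ENNReal.ofReal r * (μ (ball (0 : E) r) ^ a * Kw * N) := by rw [h2]; gcongr
    _ = Kw * ENNReal.ofReal r * μ (ball (0 : E) r) ^ a * N := by ring

/-- **Two-point estimate on a convex open set** (Evans, *PDE*, §5.6.2, Theorem 4, proof,
Step 3; Adams 1975, proof of Lemma 5.17, (28)): with `K` twice the constant of the
mean-oscillation estimate, for `x, y ∈ Ω`, `r > 0` and a measurable `W ⊆ Ω ∩ B(x, r) ∩ B(y, r)`,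
`μ(W) ‖h x - h y‖ ≤ K r μ(B(0,r))^{1-1/p} ‖Dh‖_{L^p(Ω)}` (average the two mean-oscillation
estimates over `W`). [cite: Evans2010, §5.6.2 Theorem 4 (proof, Step 3)] -/
theorem mul_enorm_sub_le_of_convex [CompleteSpace F] {p : ℝ≥0} (hp1 : 1 ≤ p)
    (hp : (finrank ℝ E : ℝ) < p) :
    ∃ K : ℝ≥0∞, K < ⊤ ∧ ∀ ⦃Ω : Set E⦄, IsOpen Ω → Convex ℝ Ω → ∀ ⦃h : E → F⦄,
      ContDiffOn ℝ 1 h Ω → ∀ ⦃x y : E⦄, x ∈ Ω → y ∈ Ω → ∀ ⦃r : ℝ⦄, 0 < r → ∀ ⦃W : Set E⦄,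
      MeasurableSet W → W ⊆ Ω → W ⊆ ball x r → W ⊆ ball y r →
      μ W * ‖h x - h y‖ₑ ≤
        K * ENNReal.ofReal r * μ (ball (0 : E) r) ^ (1 - (p : ℝ)⁻¹) *
          eLpNorm (fderiv ℝ h) p (μ.restrict Ω) := by
  obtain ⟨K, hK, hosc⟩ := lintegral_enorm_sub_le_of_convex μ (F := F) hp1 hp
  refine ⟨2 * K, ENNReal.mul_lt_top (by simp) hK,
    fun Ω hΩo hΩc h hh x y hx hy r hr W hWm hWΩ hWx hWy => ?_⟩
  set a : ℝ := 1 - (p : ℝ)⁻¹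
  set N := eLpNorm (fderiv ℝ h) p (μ.restrict Ω)
  have hmeas : ∀ w : E, AEMeasurable (fun z => ‖h z - h w‖ₑ) (μ.restrict W) := fun w =>
    (((hh.continuousOn.mono hWΩ).sub continuousOn_const).enorm).aemeasurable hWm
  calc μ W * ‖h x - h y‖ₑ = ∫⁻ _ in W, ‖h x - h y‖ₑ ∂μ := by
        rw [setLIntegral_const, mul_comm]
    _ ≤ ∫⁻ z in W, (‖h z - h x‖ₑ + ‖h z - h y‖ₑ) ∂μ := by
        refine lintegral_mono fun z => ?_
        calc ‖h x - h y‖ₑ = ‖(h x - h z) + (h z - h y)‖ₑ := by rw [sub_add_sub_cancel]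
          _ ≤ ‖h x - h z‖ₑ + ‖h z - h y‖ₑ := enorm_add_le _ _
          _ = ‖h z - h x‖ₑ + ‖h z - h y‖ₑ := by rw [enorm_sub_rev]
    _ = (∫⁻ z in W, ‖h z - h x‖ₑ ∂μ) + ∫⁻ z in W, ‖h z - h y‖ₑ ∂μ :=
        lintegral_add_left' (hmeas x) _
    _ ≤ K * ENNReal.ofReal r * μ (ball (0 : E) r) ^ a * N +
          K * ENNReal.ofReal r * μ (ball (0 : E) r) ^ a * N :=
        add_le_add (hosc hΩo hΩc hh hx hr hWm (subset_inter hWΩ hWx))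
          (hosc hΩo hΩc hh hy hr hWm (subset_inter hWΩ hWy))
    _ = 2 * K * ENNReal.ofReal r * μ (ball (0 : E) r) ^ a * N := by ring

/-- **One-point estimate on a convex open set** (Evans, *PDE*, §5.6.2, Theorem 4, proof,
Step 2; Adams 1975, (25) in Lemma 5.15, case `m = 1`): with `K` from the mean-oscillation
estimate, for `x ∈ Ω`, `r > 0` and a measurable `W ⊆ Ω ∩ B(x, r)`,
`μ(W) ‖h x‖ ≤ ∫_W ‖h‖ dμ + K r μ(B(0,r))^{1-1/p} ‖Dh‖_{L^p(Ω)}`. [cite: Evans2010, §5.6.2 Theorem 4 (proof, Step 2)] -/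
theorem mul_enorm_le_of_convex [CompleteSpace F] {p : ℝ≥0} (hp1 : 1 ≤ p)
    (hp : (finrank ℝ E : ℝ) < p) :
    ∃ K : ℝ≥0∞, K < ⊤ ∧ ∀ ⦃Ω : Set E⦄, IsOpen Ω → Convex ℝ Ω → ∀ ⦃h : E → F⦄,
      ContDiffOn ℝ 1 h Ω → ∀ ⦃x : E⦄, x ∈ Ω → ∀ ⦃r : ℝ⦄, 0 < r → ∀ ⦃W : Set E⦄,
      MeasurableSet W → W ⊆ Ω ∩ ball x r →
      μ W * ‖h x‖ₑ ≤ (∫⁻ z in W, ‖h z‖ₑ ∂μ) +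
        K * ENNReal.ofReal r * μ (ball (0 : E) r) ^ (1 - (p : ℝ)⁻¹) *
          eLpNorm (fderiv ℝ h) p (μ.restrict Ω) := by
  obtain ⟨K, hK, hosc⟩ := lintegral_enorm_sub_le_of_convex μ (F := F) hp1 hp
  refine ⟨K, hK, fun Ω hΩo hΩc h hh x hx r hr W hWm hW => ?_⟩
  have hWΩ : W ⊆ Ω := fun z hz => (hW hz).1
  have hmeas : AEMeasurable (fun z => ‖h z‖ₑ) (μ.restrict W) :=
    ((hh.continuousOn.mono hWΩ).enorm).aemeasurable hWm
  calc μ W * ‖h x‖ₑ = ∫⁻ _ in W, ‖h x‖ₑ ∂μ := by rw [setLIntegral_const, mul_comm]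
    _ ≤ ∫⁻ z in W, (‖h z‖ₑ + ‖h z - h x‖ₑ) ∂μ := by
        refine lintegral_mono fun z => ?_
        calc ‖h x‖ₑ = ‖h z - (h z - h x)‖ₑ := by rw [sub_sub_cancel]
          _ ≤ ‖h z‖ₑ + ‖h z - h x‖ₑ := enorm_sub_le
    _ = (∫⁻ z in W, ‖h z‖ₑ ∂μ) + ∫⁻ z in W, ‖h z - h x‖ₑ ∂μ := lintegral_add_left' hmeas _
    _ ≤ _ := add_le_add le_rfl (hosc hΩo hΩc hh hx hr hWm hW)

/-! ### Convex bodies: the Hölder and sup estimates -/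

omit [MeasurableSpace E] [BorelSpace E] [FiniteDimensional ℝ E] in
/-- **Witness balls in a convex set**: if the convex set `Ω` contains the ball `B(c₀, R₀)` and
`m ∈ Ω`, then for `0 < s ≤ 1` the ball `B(m + s (c₀ - m), s R₀)` — the image of `B(c₀, R₀)`
under the homothety of ratio `s` about `m` — lies in `Ω` (the uniform cone property of a convex
body, Adams, *Sobolev Spaces* (1975), ¶4.3–¶4.7). [folklore] -/
theorem ball_add_smul_sub_subset_of_convex {Ω : Set E} (hΩc : Convex ℝ Ω) {c₀ m : E} {R₀ s : ℝ}
    (hball : ball c₀ R₀ ⊆ Ω) (hm : m ∈ Ω) (hs0 : 0 < s) (hs1 : s ≤ 1) :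
    ball (m + s • (c₀ - m)) (s * R₀) ⊆ Ω := by
  intro w hw
  rw [mem_ball_iff_norm] at hw
  set b : E := c₀ + s⁻¹ • (w - (m + s • (c₀ - m))) with hb
  have hbΩ : b ∈ Ω := by
    refine hball ?_
    rw [mem_ball_iff_norm, hb, add_sub_cancel_left, norm_smul, norm_inv,
      Real.norm_of_nonneg hs0.le, inv_mul_lt_iff₀ hs0]
    exact hw
  have hw_eq : w = (1 - s) • m + s • b := by
    rw [hb, smul_add, smul_smul, mul_inv_cancel₀ hs0.ne', one_smul, sub_smul, one_smul, smul_sub]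
    abel
  rw [hw_eq]
  exact hΩc hm hbΩ (by linarith) hs0.le (by ring)

omit [MeasurableSpace E] [BorelSpace E] [FiniteDimensional ℝ E] in
/-- The witness ball `B(m + s (c₀ - m), s R₀)` lies in `B(m, s (R₀ + D))` as soon as
`‖c₀ - m‖ < D`. [folklore] -/
theorem ball_add_smul_sub_subset_ball {c₀ m : E} {R₀ D s : ℝ} (hs0 : 0 < s)
    (hD : ‖c₀ - m‖ < D) :
    ball (m + s • (c₀ - m)) (s * R₀) ⊆ ball m (s * (R₀ + D)) := by
  intro w hw
  rw [mem_ball_iff_norm] at hw ⊢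
  calc ‖w - m‖ = ‖(w - (m + s • (c₀ - m))) + s • (c₀ - m)‖ := by congr 1; abel
    _ ≤ ‖w - (m + s • (c₀ - m))‖ + ‖s • (c₀ - m)‖ := norm_add_le _ _
    _ < s * R₀ + s * D := by
        refine add_lt_add_of_lt_of_le hw ?_
        rw [norm_smul, Real.norm_of_nonneg hs0.le]
        exact mul_le_mul_of_nonneg_left hD.le hs0.le
    _ = s * (R₀ + D) := by ring

/-- **Morrey's Hölder estimate on a convex body** (Adams, *Sobolev Spaces* (1975), Lemma 5.17
with (28)–(29): `|u(x) - u(y)| ≤ K |x - y|^{1 - n/p} ‖grad u‖_{0,p,Ω}` on a domain with the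
strong local Lipschitz property, proved on convex cells; Evans, *PDE*, §5.6.2, Theorem 4,
Step 3 and the Remark after Theorem 5): for `1 ≤ p`, `n = dim E < p` and a convex open `Ω`
with `B(c₀, R₀) ⊆ Ω ⊆ B(c₀, D)` there is a finite `C` (depending only on `E, μ, p, R₀, D`)
such that every map `h` of class `C¹` on `Ω` satisfies
`‖h x - h y‖ ≤ C ‖Dh‖_{L^p(Ω)} ‖x - y‖^{1-n/p}` for all `x, y ∈ Ω`. The witness set for the
two-point estimate at distance `r = |x - y|` is the ball `B(m + s(c₀ - m), s R₀)`,
`m` the midpoint, `s = r / (2(R₀ + D))`, contained in `Ω ∩ B(m, r/2) ⊆ B(x,r) ∩ B(y,r)` and of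
measure `(s R₀)ⁿ μ(B₁)`. [cite: Adams1975, Lemma 5.17 ((28)–(29))] -/
theorem morrey_holder_of_convex [CompleteSpace F] {p : ℝ≥0} (hp1 : 1 ≤ p)
    (hp : (finrank ℝ E : ℝ) < p) {Ω : Set E} (hΩo : IsOpen Ω) (hΩc : Convex ℝ Ω) {c₀ : E}
    {R₀ D : ℝ} (hR₀ : 0 < R₀) (hball : ball c₀ R₀ ⊆ Ω) (hD : Ω ⊆ ball c₀ D) :
    ∃ C : ℝ≥0∞, C < ⊤ ∧ ∀ ⦃h : E → F⦄, ContDiffOn ℝ 1 h Ω → ∀ ⦃x y : E⦄, x ∈ Ω → y ∈ Ω →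
      ‖h x - h y‖ₑ ≤ C * eLpNorm (fderiv ℝ h) p (μ.restrict Ω) *
        edist x y ^ (1 - (finrank ℝ E : ℝ) / p) := by
  obtain ⟨K, hK, htwo⟩ := mul_enorm_sub_le_of_convex μ (F := F) hp1 hp
  set n := finrank ℝ E with hn
  set a : ℝ := 1 - (p : ℝ)⁻¹ with ha
  set V := μ (ball (0 : E) 1) with hV
  have hV0 : V ≠ 0 := (measure_ball_pos μ (0 : E) one_pos).ne'
  have hVtop : V ≠ ⊤ := measure_ball_lt_top.ne
  have hp0 : (0 : ℝ) < p := lt_of_lt_of_le zero_lt_one (by exact_mod_cast hp1)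
  have ha0 : 0 ≤ a := by
    rw [ha, sub_nonneg]; exact inv_le_one_of_one_le₀ (by exact_mod_cast hp1)
  have hD0 : 0 < D := by
    have : c₀ ∈ ball c₀ D := hD (hball (mem_ball_self hR₀))
    simpa using this
  -- the ratio `κ = R₀ / (2 (R₀ + D))` of the witness balls
  set κ : ℝ := R₀ / (2 * (R₀ + D)) with hκ
  have hκ0 : 0 < κ := by positivity
  refine ⟨K * V ^ a * V⁻¹ * ENNReal.ofReal ((κ ^ n)⁻¹), ?_, fun h hh x y hx hy => ?_⟩
  · refine ENNReal.mul_lt_top (ENNReal.mul_lt_top (ENNReal.mul_lt_top hK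
      (ENNReal.rpow_lt_top_of_nonneg ha0 hVtop))
      (ENNReal.inv_lt_top.2 (pos_iff_ne_zero.2 hV0))) ENNReal.ofReal_lt_top
  set N := eLpNorm (fderiv ℝ h) p (μ.restrict Ω)
  rcases eq_or_ne x y with rfl | hxy
  · simp
  set r : ℝ := dist x y with hr
  have hr0 : 0 < r := dist_pos.2 hxy
  -- the witness ball
  set m : E := midpoint ℝ x y with hm
  have hmΩ : m ∈ Ω := hΩc.midpoint_mem hx hy
  set s : ℝ := r / (2 * (R₀ + D)) with hs
  have hs0 : 0 < s := by positivity
  have hxD : dist x c₀ < D := mem_ball.1 (hD hx)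
  have hyD : dist y c₀ < D := mem_ball.1 (hD hy)
  have hr2D : r < 2 * D := by
    calc r = dist x y := hr
      _ ≤ dist x c₀ + dist y c₀ := dist_triangle_right _ _ _
      _ < D + D := add_lt_add hxD hyD
      _ = 2 * D := by ring
  have hs1 : s ≤ 1 := by
    rw [hs, div_le_one (by positivity)]
    nlinarith
  have hcm : ‖c₀ - m‖ < D := by
    rw [← dist_eq_norm, dist_comm]; exact mem_ball.1 (hD hmΩ)
  set W := ball (m + s • (c₀ - m)) (s * R₀) with hW
  have hWΩ : W ⊆ Ω := ball_add_smul_sub_subset_of_convex hΩc hball hmΩ hs0 hs1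
  have hWm' : W ⊆ ball m (r / 2) := by
    refine (ball_add_smul_sub_subset_ball hs0 hcm).trans (ball_subset_ball ?_)
    rw [hs]
    field_simp
    exact le_rfl
  have hWx : W ⊆ ball x r := by
    refine hWm'.trans fun z hz => ?_
    rw [mem_ball] at hz ⊢
    calc dist z x ≤ dist z m + dist m x := dist_triangle _ _ _
      _ < r / 2 + r / 2 := by
          refine add_lt_add_of_lt_of_le hz ?_
          rw [hm, dist_comm, dist_left_midpoint, hr, Real.norm_of_nonneg (by norm_num)]
          exact le_of_eq (by ring)
      _ = r := by ring
  have hWy : W ⊆ ball y r := by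
    refine hWm'.trans fun z hz => ?_
    rw [mem_ball] at hz ⊢
    calc dist z y ≤ dist z m + dist m y := dist_triangle _ _ _
      _ < r / 2 + r / 2 := by
          refine add_lt_add_of_lt_of_le hz ?_
          rw [hm, dist_comm, dist_right_midpoint, hr, Real.norm_of_nonneg (by norm_num)]
          exact le_of_eq (by ring)
      _ = r := by ring
  have key : μ W * ‖h x - h y‖ₑ ≤ K * ENNReal.ofReal r * μ (ball (0 : E) r) ^ a * N :=
    htwo hΩo hΩc hh hx hy hr0 measurableSet_ball hWΩ hWx hWy
  -- measures of the balls involved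
  have hBr : μ (ball (0 : E) r) = ENNReal.ofReal (r ^ n) * V :=
    Measure.addHaar_ball_of_pos μ (0 : E) hr0
  have hsR : s * R₀ = κ * r := by rw [hs, hκ]; field_simp
  have hWμ : μ W = ENNReal.ofReal ((κ * r) ^ n) * V := by
    rw [hW, Measure.addHaar_ball_center, hsR, Measure.addHaar_ball_of_pos μ (0 : E) (by positivity)]
  have hW0 : μ W ≠ 0 := (measure_ball_pos μ _ (by positivity)).ne'
  have hWtop : μ W ≠ ⊤ := measure_ball_lt_top.ne
  -- the real-number identity behind the constants
  have hreal : ((κ * r) ^ n)⁻¹ * (r * (r ^ n) ^ a) = (κ ^ n)⁻¹ * r ^ (1 - (n : ℝ) / p) := by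
    have h2 : (r ^ n) ^ a = r ^ n * r ^ (-((n : ℝ) / p)) := by
      rw [← Real.rpow_natCast r n, ← Real.rpow_mul hr0.le, ← Real.rpow_add hr0, ha]
      congr 1
      field_simp
      ring
    have h3 : r * r ^ (-((n : ℝ) / p)) = r ^ (1 - (n : ℝ) / p) := by
      conv_lhs => rw [← Real.rpow_one r]
      rw [← Real.rpow_mul hr0.le, ← Real.rpow_add hr0]
      congr 1
      ring
    rw [mul_pow, mul_inv, h2, ← h3]
    field_simp
  have hedist : edist x y ^ (1 - (n : ℝ) / p) = ENNReal.ofReal (r ^ (1 - (n : ℝ) / p)) := by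
    rw [edist_dist, ← hr, ENNReal.ofReal_rpow_of_pos hr0]
  calc ‖h x - h y‖ₑ = (μ W)⁻¹ * (μ W * ‖h x - h y‖ₑ) := by
        rw [← mul_assoc, ENNReal.inv_mul_cancel hW0 hWtop, one_mul]
    _ ≤ (μ W)⁻¹ * (K * ENNReal.ofReal r * μ (ball (0 : E) r) ^ a * N) := by gcongr
    _ = ENNReal.ofReal (((κ * r) ^ n)⁻¹ * (r * (r ^ n) ^ a)) *
          (V⁻¹ * V) * (K * V ^ a * V⁻¹ * N) := by
        rw [hWμ, hBr, ENNReal.mul_inv (Or.inr hVtop) (Or.inr hV0),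
          ENNReal.mul_rpow_of_nonneg _ _ ha0, ← ENNReal.ofReal_inv_of_pos (by positivity),
          ENNReal.ofReal_rpow_of_pos (by positivity), ENNReal.ofReal_mul (by positivity),
          ENNReal.ofReal_mul (by positivity), ENNReal.inv_mul_cancel hV0 hVtop]
        ring
    _ = K * V ^ a * V⁻¹ * ENNReal.ofReal ((κ ^ n)⁻¹) * N * edist x y ^ (1 - (n : ℝ) / p) := by
        rw [hreal, hedist, ENNReal.inv_mul_cancel hV0 hVtop, ENNReal.ofReal_mul (by positivity)]
        ring

/-- **Morrey's sup estimate on a convex body** (Evans, *PDE*, §5.6.2, Theorem 4, proof,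
Step 2; Adams, *Sobolev Spaces* (1975), (25) in Lemma 5.15, case `m = 1`, `p > n`, for domains
with the cone property): for `1 ≤ p`, `n = dim E < p` and a convex open `Ω` with
`B(c₀, R₀) ⊆ Ω ⊆ B(c₀, D)` there is a finite `C` (depending only on `E, μ, p, R₀, D`) with
`‖h x‖ ≤ C (‖h‖_{L^p(Ω)} + ‖Dh‖_{L^p(Ω)})` for every map `h` of class `C¹` on `Ω` and every
`x ∈ Ω` (one-point estimate on the witness ball `B(x + (c₀ - x)/2, R₀/2) ⊆ Ω ∩ B(x, R₀ + D)`
and Hölder). [cite: Adams1975, Lemma 5.15 ((25), case m = 1)] [cite: Evans2010, §5.6.2 Theorem 4 (proof, Step 2)] -/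
theorem morrey_sup_of_convex [CompleteSpace F] {p : ℝ≥0} (hp1 : 1 ≤ p)
    (hp : (finrank ℝ E : ℝ) < p) {Ω : Set E} (hΩo : IsOpen Ω) (hΩc : Convex ℝ Ω) {c₀ : E}
    {R₀ D : ℝ} (hR₀ : 0 < R₀) (hball : ball c₀ R₀ ⊆ Ω) (hD : Ω ⊆ ball c₀ D) :
    ∃ C : ℝ≥0∞, C < ⊤ ∧ ∀ ⦃h : E → F⦄, ContDiffOn ℝ 1 h Ω → ∀ ⦃x : E⦄, x ∈ Ω →
      ‖h x‖ₑ ≤ C * (eLpNorm h p (μ.restrict Ω) + eLpNorm (fderiv ℝ h) p (μ.restrict Ω)) := by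
  obtain ⟨K, hK, hone⟩ := mul_enorm_le_of_convex μ (F := F) hp1 hp
  set n := finrank ℝ E with hn
  set a : ℝ := 1 - (p : ℝ)⁻¹ with ha
  have ha0 : 0 ≤ a := by
    rw [ha, sub_nonneg]; exact inv_le_one_of_one_le₀ (by exact_mod_cast hp1)
  have hD0 : 0 < D := by
    have : c₀ ∈ ball c₀ D := hD (hball (mem_ball_self hR₀))
    simpa using this
  -- the measure of the witness balls and the radius of the enclosing balls
  set M₀ := μ (ball (0 : E) (2⁻¹ * R₀)) with hM₀
  have hM₀0 : M₀ ≠ 0 := (measure_ball_pos μ (0 : E) (by positivity)).ne'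
  have hM₀top : M₀ ≠ ⊤ := measure_ball_lt_top.ne
  set ρ : ℝ := R₀ + D with hρ
  have hρ0 : 0 < ρ := by positivity
  set K' := K * ENNReal.ofReal ρ * μ (ball (0 : E) ρ) ^ a with hK'
  have hK'top : K' < ⊤ := ENNReal.mul_lt_top (ENNReal.mul_lt_top hK ENNReal.ofReal_lt_top)
    (ENNReal.rpow_lt_top_of_nonneg ha0 measure_ball_lt_top.ne)
  refine ⟨M₀⁻¹ * (M₀ ^ a + K'), ENNReal.mul_lt_top (ENNReal.inv_lt_top.2 (pos_iff_ne_zero.2 hM₀0))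
    (ENNReal.add_lt_top.2 ⟨ENNReal.rpow_lt_top_of_nonneg ha0 hM₀top, hK'top⟩), fun h hh x hx => ?_⟩
  have hcx : ‖c₀ - x‖ < D := by
    rw [← dist_eq_norm, dist_comm]; exact mem_ball.1 (hD hx)
  set W := ball (x + (2⁻¹ : ℝ) • (c₀ - x)) (2⁻¹ * R₀) with hW
  have hWΩ : W ⊆ Ω :=
    ball_add_smul_sub_subset_of_convex hΩc hball hx (by norm_num) (by norm_num)
  have hWx : W ⊆ ball x ρ := by
    refine (ball_add_smul_sub_subset_ball (by norm_num) hcx).trans (ball_subset_ball ?_)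
    rw [hρ]; nlinarith
  have hWμ : μ W = M₀ := by rw [hW, Measure.addHaar_ball_center]
  -- Hölder on the witness ball
  have hL1 : ∫⁻ z in W, ‖h z‖ₑ ∂μ ≤ eLpNorm h p (μ.restrict Ω) * M₀ ^ a := by
    calc ∫⁻ z in W, ‖h z‖ₑ ∂μ
        = eLpNorm h 1 (μ.restrict W) := eLpNorm_one_eq_lintegral_enorm.symm
      _ ≤ eLpNorm h p (μ.restrict W) *
            (μ.restrict W) univ ^ (1 / (1 : ℝ≥0∞).toReal - 1 / ((p : ℝ≥0∞)).toReal) :=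
          eLpNorm_le_eLpNorm_mul_rpow_measure_univ (by exact_mod_cast hp1)
            ((hh.continuousOn.mono hWΩ).aestronglyMeasurable measurableSet_ball)
      _ ≤ eLpNorm h p (μ.restrict Ω) * M₀ ^ a := by
          rw [Measure.restrict_apply_univ, hWμ]
          have hexp : 1 / (1 : ℝ≥0∞).toReal - 1 / ((p : ℝ≥0∞)).toReal = a := by simp [ha]
          rw [hexp]
          exact mul_le_mul' (eLpNorm_mono_measure _ (Measure.restrict_mono hWΩ le_rfl)) le_rfl
  have hmain : M₀ * ‖h x‖ₑ ≤ (∫⁻ z in W, ‖h z‖ₑ ∂μ) + K' * eLpNorm (fderiv ℝ h) p (μ.restrict Ω) := by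
    rw [← hWμ]
    exact hone hΩo hΩc hh hx hρ0 measurableSet_ball (subset_inter hWΩ hWx)
  calc ‖h x‖ₑ = M₀⁻¹ * (M₀ * ‖h x‖ₑ) := by
        rw [← mul_assoc, ENNReal.inv_mul_cancel hM₀0 hM₀top, one_mul]
    _ ≤ M₀⁻¹ * (eLpNorm h p (μ.restrict Ω) * M₀ ^ a +
          K' * eLpNorm (fderiv ℝ h) p (μ.restrict Ω)) := by
        gcongr
        exact hmain.trans (add_le_add hL1 le_rfl)
    _ ≤ M₀⁻¹ * ((M₀ ^ a + K') *
          (eLpNorm h p (μ.restrict Ω) + eLpNorm (fderiv ℝ h) p (μ.restrict Ω))) := by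
        gcongr
        calc eLpNorm h p (μ.restrict Ω) * M₀ ^ a + K' * eLpNorm (fderiv ℝ h) p (μ.restrict Ω)
            = M₀ ^ a * eLpNorm h p (μ.restrict Ω) +
                K' * eLpNorm (fderiv ℝ h) p (μ.restrict Ω) := by ring
          _ ≤ (M₀ ^ a * eLpNorm h p (μ.restrict Ω) +
                M₀ ^ a * eLpNorm (fderiv ℝ h) p (μ.restrict Ω)) +
              (K' * eLpNorm h p (μ.restrict Ω) +
                K' * eLpNorm (fderiv ℝ h) p (μ.restrict Ω)) :=
              add_le_add le_self_add le_add_self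
          _ = _ := by ring
    _ = _ := by rw [mul_assoc]

end Morrey

end Literature.Analysis.FunctionSpaces
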